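import Mathlib
import Literature.Probability.RandomPlanarGeometry.HexSAWObservable
import Summits.CriticalPhenomena.SAWScalingLimit.Theorems.NoFoldBound.Negative.SingletonTightness
import Summits.CriticalPhenomena.SAWScalingLimit.Theorems.SAWDevelopingMapNoFoldBoundAlgebraA

/-!
# `NoFoldBound`, line `Ideator3Sketch`: the source-triple inequality and the stub `stub_algebra`

Crux `NoFoldBound` (stmt-CriticalPhenomena-8296), route `SAWDevelopingMap`.  This file proves the
second finite-dimensional inequality of the stub `stub_algebra` of the line skeleton
(`stub_algebra_B`) and assembles the stub itself (`stub_algebra = ⟨stub_algebra_A, stub_algebra_B⟩`,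
part A being `SAWDevelopingMapNoFoldBoundAlgebraA.lean`).

Part B (source triple): for `c < sin(π/8)` there is `k < 1` such that for `Z, Z' ∈ [0, c]`,
`ε = ±1`, `F_u = 1`, `F₁ = x e(επ/3) + x e(4επ/3) Z`, `F₂ = x e(-επ/3) + x e(-4επ/3) Z'`
(`e(t) = e^{-iσt}`, `σ = 5/8`, `x = x_c`), all six labellings `(G₀, G₁, G₂)` of `(F_u, F₁, F₂)`
satisfy `‖G₀ + ωG₁ + ω²G₂‖ ≤ k ‖F_u + F₁ + F₂‖` (`ω = e^{2πi/3}`).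

Proof (say `ε = 1`; `ε = -1` is the same computation with `F₁ ↔ F₂`, `Z ↔ Z'`): with
`A = α_T - (√3/2)x(Z+Z')`, `B = β_T + (√3/2)x(Z+Z')`, `D = (x/2)(Z'-Z)` one has exactly
`F_u + F₁ + F₂ = A + iD`, `F_u + ωF₁ + ω²F₂ = B + iD`, `F_u + ωF₂ + ω²F₁ = i x (Z - Z')`
(`e(±4π/3) = e^{∓5πi/6}`, `ω e^{-5πi/6} = e^{-πi/6}`, `ω e^{5πi/6} = -i`, and the brackets
`1 + 2x cos(11π/24) = β_T`, `1 - 2x cos(π/8) = 0` of part A); the other labellings are these times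
units.  Since `α_T - β_T = 2√3 x sin(π/8)` (`cos a - cos b = -2 sin((a+b)/2) sin((a-b)/2)`),
`B² - A² = -(α_T + β_T)(2√3 x sin(π/8) - √3 x (Z+Z')) ≤ -m`,
`m = (α_T+β_T) 2√3 x (sin(π/8) - c) > 0`, so `‖B + iD‖² ≤ ‖A + iD‖² - m ≤ (1 - m/10)² ‖A + iD‖²`
using `‖A + iD‖² ≤ 5`; and `x|Z - Z'| ≤ xc ≤ A/2 ≤ ‖A + iD‖/2` (`x_c < 0.55`,
`c < sin(π/8) < 0.394`, `√3 < 1.7321`).  Hence `k = max(1/2, 1 - m/10) < 1` works.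
-/

noncomputable section

open Literature.Probability.RandomPlanarGeometry.SAW

namespace Summit.CriticalPhenomena.SAWScalingLimit.Theorems.SAWDevelopingMapNoFoldBound

/-! ## Special values for the source triple -/

/-- `e^{-5πi/6} = -√3/2 - i/2`. -/
theorem expI_neg_five_pi_div_six : Complex.exp ((-(5 * Real.pi / 6) : ℝ) * Complex.I) =
    ((-Real.sqrt 3 / 2 : ℝ) : ℂ) + ((-(1 / 2) : ℝ) : ℂ) * Complex.I := by
  apply Complex.ext
  · simp only [Complex.exp_ofReal_mul_I_re, Complex.add_re, Complex.mul_re, Complex.ofReal_re,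
      Complex.ofReal_im, Complex.I_re, Complex.I_im, mul_zero, zero_mul, sub_zero, add_zero]
    rw [Real.cos_neg, show 5 * Real.pi / 6 = Real.pi - Real.pi / 6 by ring, Real.cos_pi_sub,
      Real.cos_pi_div_six]; ring
  · simp only [Complex.exp_ofReal_mul_I_im, Complex.add_im, Complex.mul_im, Complex.ofReal_re,
      Complex.ofReal_im, Complex.I_re, Complex.I_im, mul_zero, mul_one, zero_add, add_zero]
    rw [Real.sin_neg, show 5 * Real.pi / 6 = Real.pi - Real.pi / 6 by ring, Real.sin_pi_sub,
      Real.sin_pi_div_six]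

/-- `e^{5πi/6} = -√3/2 + i/2`. -/
theorem expI_five_pi_div_six : Complex.exp ((5 * Real.pi / 6 : ℝ) * Complex.I) =
    ((-Real.sqrt 3 / 2 : ℝ) : ℂ) + ((1 / 2 : ℝ) : ℂ) * Complex.I := by
  apply Complex.ext
  · simp only [Complex.exp_ofReal_mul_I_re, Complex.add_re, Complex.mul_re, Complex.ofReal_re,
      Complex.ofReal_im, Complex.I_re, Complex.I_im, mul_zero, zero_mul, sub_zero, add_zero]
    rw [show 5 * Real.pi / 6 = Real.pi - Real.pi / 6 by ring, Real.cos_pi_sub,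
      Real.cos_pi_div_six]; ring
  · simp only [Complex.exp_ofReal_mul_I_im, Complex.add_im, Complex.mul_im, Complex.ofReal_re,
      Complex.ofReal_im, Complex.I_re, Complex.I_im, mul_zero, mul_one, zero_add, add_zero]
    rw [show 5 * Real.pi / 6 = Real.pi - Real.pi / 6 by ring, Real.sin_pi_sub, Real.sin_pi_div_six]

/-- `ω e^{-5πi/6} = e^{-πi/6} = √3/2 - i/2` (`ω = e^{2πi/3}`). -/
theorem omega_mul_expI_neg_five_pi_div_six :
    Complex.exp ((2 * Real.pi / 3 : ℝ) * Complex.I) *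
      Complex.exp ((-(5 * Real.pi / 6) : ℝ) * Complex.I) =
      ((Real.sqrt 3 / 2 : ℝ) : ℂ) + ((-(1 / 2) : ℝ) : ℂ) * Complex.I := by
  rw [expI_mul, show 2 * Real.pi / 3 + -(5 * Real.pi / 6) = -(Real.pi / 6) by ring]
  apply Complex.ext
  · simp only [Complex.exp_ofReal_mul_I_re, Complex.add_re, Complex.mul_re, Complex.ofReal_re,
      Complex.ofReal_im, Complex.I_re, Complex.I_im, mul_zero, zero_mul, sub_zero, add_zero]
    rw [Real.cos_neg, Real.cos_pi_div_six]
  · simp only [Complex.exp_ofReal_mul_I_im, Complex.add_im, Complex.mul_im, Complex.ofReal_re,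
      Complex.ofReal_im, Complex.I_re, Complex.I_im, mul_zero, mul_one, zero_add, add_zero]
    rw [Real.sin_neg, Real.sin_pi_div_six]

/-- `ω² e^{5πi/6} = e^{πi/6} = √3/2 + i/2`. -/
theorem omega_sq_mul_expI_five_pi_div_six :
    Complex.exp ((2 * Real.pi / 3 : ℝ) * Complex.I) ^ 2 *
      Complex.exp ((5 * Real.pi / 6 : ℝ) * Complex.I) =
      ((Real.sqrt 3 / 2 : ℝ) : ℂ) + ((1 / 2 : ℝ) : ℂ) * Complex.I := by
  rw [expI_sq, expI_mul, expI_eq_expI_sub_two_pi,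
    show 2 * (2 * Real.pi / 3) + 5 * Real.pi / 6 - 2 * Real.pi = Real.pi / 6 by ring]
  apply Complex.ext
  · simp only [Complex.exp_ofReal_mul_I_re, Complex.add_re, Complex.mul_re, Complex.ofReal_re,
      Complex.ofReal_im, Complex.I_re, Complex.I_im, mul_zero, zero_mul, sub_zero, add_zero]
    rw [Real.cos_pi_div_six]
  · simp only [Complex.exp_ofReal_mul_I_im, Complex.add_im, Complex.mul_im, Complex.ofReal_re,
      Complex.ofReal_im, Complex.I_re, Complex.I_im, mul_zero, mul_one, zero_add, add_zero]
    rw [Real.sin_pi_div_six]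

/-- `ω e^{5πi/6} = e^{3πi/2} = -i`. -/
theorem omega_mul_expI_five_pi_div_six :
    Complex.exp ((2 * Real.pi / 3 : ℝ) * Complex.I) *
      Complex.exp ((5 * Real.pi / 6 : ℝ) * Complex.I) = -Complex.I := by
  rw [expI_mul, expI_eq_expI_sub_two_pi,
    show 2 * Real.pi / 3 + 5 * Real.pi / 6 - 2 * Real.pi = -(Real.pi / 2) by ring]
  apply Complex.ext
  · simp only [Complex.exp_ofReal_mul_I_re, Complex.neg_re, Complex.I_re, neg_zero]
    rw [Real.cos_neg, Real.cos_pi_div_two]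
  · simp only [Complex.exp_ofReal_mul_I_im, Complex.neg_im, Complex.I_im]
    rw [Real.sin_neg, Real.sin_pi_div_two]

/-- `ω² e^{-5πi/6} = e^{πi/2} = i`. -/
theorem omega_sq_mul_expI_neg_five_pi_div_six :
    Complex.exp ((2 * Real.pi / 3 : ℝ) * Complex.I) ^ 2 *
      Complex.exp ((-(5 * Real.pi / 6) : ℝ) * Complex.I) = Complex.I := by
  rw [expI_sq, expI_mul, show 2 * (2 * Real.pi / 3) + -(5 * Real.pi / 6) = Real.pi / 2 by ring]
  apply Complex.ext
  · simp only [Complex.exp_ofReal_mul_I_re, Complex.I_re]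
    rw [Real.cos_pi_div_two]
  · simp only [Complex.exp_ofReal_mul_I_im, Complex.I_im]
    rw [Real.sin_pi_div_two]

/-! ## The source triple: real-variable form -/

/-- **The real inequalities behind part B.** On the box `0 ≤ Y, Y' ≤ c` (`c < sin(π/8)`), with
`A = α_T - (√3/2)x(Y+Y')`, `B = β_T + (√3/2)x(Y+Y')`, `D = (x/2)(Y'-Y)` (`x = x_c`), the margin
`m = (α_T + β_T) · 2√3 x (sin(π/8) - c)` and `k = max(1/2, 1 - m/10)`:
if `S² = A² + D²` and `L² = B² + D²` (`S, L ≥ 0`) then `L ≤ k S` and `x |Y - Y'| ≤ k S`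
(`L² - S² = -(α_T+β_T)(α_T - β_T - √3 x (Y+Y')) ≤ -m` as `α_T - β_T = 2√3 x sin(π/8)`; `S² ≤ 5`;
`x|Y - Y'| ≤ x c ≤ A/2 ≤ S/2`). -/
theorem partB_real {c Y Y' S L m k : ℝ} (hc : c < Real.sin (Real.pi / 8)) (hY0 : 0 ≤ Y)
    (hYc : Y ≤ c) (hY'0 : 0 ≤ Y') (hY'c : Y' ≤ c) (hS0 : 0 ≤ S) (hL0 : 0 ≤ L)
    (hS : S ^ 2 = (1 + 2 * hexCriticalFugacity * Real.cos (5 * Real.pi / 24) -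
        Real.sqrt 3 / 2 * hexCriticalFugacity * (Y + Y')) ^ 2 +
        (hexCriticalFugacity / 2 * (Y' - Y)) ^ 2)
    (hL : L ^ 2 = (1 + 2 * hexCriticalFugacity * Real.cos (11 * Real.pi / 24) +
        Real.sqrt 3 / 2 * hexCriticalFugacity * (Y + Y')) ^ 2 +
        (hexCriticalFugacity / 2 * (Y' - Y)) ^ 2)
    (hm : m = ((1 + 2 * hexCriticalFugacity * Real.cos (5 * Real.pi / 24)) +
      (1 + 2 * hexCriticalFugacity * Real.cos (11 * Real.pi / 24))) *
      (2 * Real.sqrt 3 * hexCriticalFugacity * (Real.sin (Real.pi / 8) - c)))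
    (hk : k = max (1 / 2) (1 - m / 10)) :
    L ≤ k * S ∧ hexCriticalFugacity * |Y - Y'| ≤ k * S := by
  have hαβ := alphaT_sub_betaT
  have hα0 := nfb_alphaT_pos
  have hβ0 := nfb_betaT_nonneg
  have hm0 : 0 < m := hm ▸ margin_pos hc
  set x := hexCriticalFugacity with hx
  set α := 1 + 2 * x * Real.cos (5 * Real.pi / 24) with hα
  set β := 1 + 2 * x * Real.cos (11 * Real.pi / 24) with hβ
  set s := Real.sin (Real.pi / 8) with hs
  have x0 : 0 < x := nfb_xc_pos
  have x55 : x < 0.55 := xc_lt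
  have s39 : s < 0.394 := sin_pi_div_eight_lt
  have r3 : Real.sqrt 3 < 1.7321 := sqrt_three_lt
  have r30 : 0 < Real.sqrt 3 := by positivity
  have hc0 : 0 ≤ c := hY0.trans hYc
  have hxc : x * c ≤ 0.2167 := by
    have h1 : x * c ≤ 0.55 * c := mul_le_mul_of_nonneg_right x55.le hc0
    linarith
  have hxc0 : 0 ≤ x * c := mul_nonneg x0.le hc0
  have hcos0 : 0 ≤ Real.cos (5 * Real.pi / 24) :=
    Real.cos_nonneg_of_mem_Icc ⟨by linarith [Real.pi_pos], by linarith [Real.pi_pos]⟩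
  have hα1 : 1 ≤ α := by
    have : 0 ≤ 2 * x * Real.cos (5 * Real.pi / 24) := by positivity
    linarith
  have hα2 : α ≤ 2.1 := by
    have h1 : 2 * x * Real.cos (5 * Real.pi / 24) ≤ 2 * x * 1 :=
      mul_le_mul_of_nonneg_left (Real.cos_le_one _) (by positivity)
    linarith
  -- `t = (√3/2) x (Y + Y') ∈ [0, √3 x c]`, `√3 x c ≤ 0.3754`
  have hYY : Y + Y' ≤ 2 * c := by linarith
  have ht0 : 0 ≤ Real.sqrt 3 / 2 * x * (Y + Y') := by positivity
  have ht1 : Real.sqrt 3 / 2 * x * (Y + Y') ≤ Real.sqrt 3 / 2 * x * (2 * c) :=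
    mul_le_mul_of_nonneg_left hYY (by positivity)
  have ht2 : Real.sqrt 3 * (x * c) ≤ 1.7321 * 0.2167 := mul_le_mul r3.le hxc hxc0 (by norm_num)
  -- the key margin inequality `L² ≤ S² - m`
  have e1 : L ^ 2 - (S ^ 2 - m) =
      (α + β) * (Real.sqrt 3 * x * (Y + Y') - 2 * Real.sqrt 3 * x * c) := by
    rw [hL, hS, hm]; linear_combination (-(α + β)) * hαβ
  have key : L ^ 2 ≤ S ^ 2 - m := by
    have h1 : (α + β) * (Real.sqrt 3 * x * (Y + Y') - 2 * Real.sqrt 3 * x * c) ≤ 0 :=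
      mul_nonpos_of_nonneg_of_nonpos (by linarith) (by linarith)
    linarith
  -- crude size bounds: `0 ≤ A ≤ 2.1`, `D² ≤ 0.012`, so `S² ≤ 5`
  have hA0 : 0 ≤ α - Real.sqrt 3 / 2 * x * (Y + Y') := by linarith
  have hA2 : α - Real.sqrt 3 / 2 * x * (Y + Y') ≤ 2.1 := by linarith
  have hDY : (Y' - Y) ^ 2 ≤ c ^ 2 := sq_le_sq' (by linarith) (by linarith)
  have hD : (x / 2 * (Y' - Y)) ^ 2 ≤ (0.2167 / 2) ^ 2 := by
    have h1 : x ^ 2 * (Y' - Y) ^ 2 ≤ (x * c) ^ 2 := by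
      rw [mul_pow]; exact mul_le_mul_of_nonneg_left hDY (sq_nonneg x)
    have h2 : (x * c) ^ 2 ≤ 0.2167 ^ 2 := pow_le_pow_left₀ hxc0 hxc 2
    have h3 : (x / 2 * (Y' - Y)) ^ 2 = x ^ 2 * (Y' - Y) ^ 2 / 4 := by ring
    rw [h3]; linarith
  have hS5 : S ^ 2 ≤ 5 := by
    have h1 : (α - Real.sqrt 3 / 2 * x * (Y + Y')) ^ 2 ≤ 2.1 ^ 2 := pow_le_pow_left₀ hA0 hA2 2
    rw [hS]; linarith
  have hmS : m ≤ S ^ 2 := by linarith [sq_nonneg L]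
  -- first labelling: `L ≤ (1 - m/10) S`
  have k0 : (0 : ℝ) ≤ 1 - m / 10 := by linarith
  have hB1 : L ≤ (1 - m / 10) * S := by
    rw [← sq_le_sq₀ hL0 (mul_nonneg k0 hS0)]
    have h1 : m * S ^ 2 ≤ m * 5 := mul_le_mul_of_nonneg_left hS5 hm0.le
    have h2 : 0 ≤ m ^ 2 * S ^ 2 := by positivity
    have h3 : ((1 - m / 10) * S) ^ 2 = S ^ 2 - m * S ^ 2 / 5 + m ^ 2 * S ^ 2 / 100 := by ring
    rw [h3]; linarith
  rw [hk]
  refine ⟨hB1.trans (mul_le_mul_of_nonneg_right (le_max_right _ _) hS0), ?_⟩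
  -- second labelling: `x |Y - Y'| ≤ x c ≤ A/2 ≤ S/2`
  have hAS : α - Real.sqrt 3 / 2 * x * (Y + Y') ≤ S :=
    (sq_le_sq₀ hA0 hS0).1 (by rw [hS]; linarith [sq_nonneg (x / 2 * (Y' - Y))])
  have h1 : x * |Y - Y'| ≤ x * c :=
    mul_le_mul_of_nonneg_left (abs_sub_le_iff.2 ⟨by linarith, by linarith⟩) x0.le
  have h2 : x * c ≤ (α - Real.sqrt 3 / 2 * x * (Y + Y')) / 2 := by linarith
  calc x * |Y - Y'| ≤ 1 / 2 * S := by linarith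
    _ ≤ max (1 / 2) (1 - m / 10) * S := mul_le_mul_of_nonneg_right (le_max_left _ _) hS0

/-! ## The source triple: complex form -/

/-- **The source triple, abstract form.** With `G₁ = x λ + x μ Y`, `G₂ = x λ' + x μ' Y'`
(`λ = e^{-5πi/24}`, `λ' = e^{5πi/24}`, `μ = e^{-5πi/6}`, `μ' = e^{5πi/6}`, `x = x_c`,
`0 ≤ Y, Y' ≤ c < sin(π/8)`), `w = e^{2πi/3}`, and `m`, `k = max(1/2, 1 - m/10)` as in `partB_real`,
all six labellings of `(1, G₁, G₂)` satisfy `‖H₀ + wH₁ + w²H₂‖ ≤ k ‖1 + G₁ + G₂‖`. -/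
theorem partB_core {c Y Y' S m k : ℝ} (hc : c < Real.sin (Real.pi / 8)) (hY0 : 0 ≤ Y)
    (hYc : Y ≤ c) (hY'0 : 0 ≤ Y') (hY'c : Y' ≤ c) (lam lam' mu mu' w G₁ G₂ : ℂ)
    (hlam : lam = Complex.exp ((-(5 * Real.pi / 24) : ℝ) * Complex.I))
    (hlam' : lam' = Complex.exp ((5 * Real.pi / 24 : ℝ) * Complex.I))
    (hmu : mu = Complex.exp ((-(5 * Real.pi / 6) : ℝ) * Complex.I))
    (hmu' : mu' = Complex.exp ((5 * Real.pi / 6 : ℝ) * Complex.I))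
    (hw : w = Complex.exp ((2 * Real.pi / 3 : ℝ) * Complex.I))
    (hG₁ : G₁ = hexCriticalFugacity * lam + hexCriticalFugacity * mu * Y)
    (hG₂ : G₂ = hexCriticalFugacity * lam' + hexCriticalFugacity * mu' * Y')
    (hS : S = ‖1 + G₁ + G₂‖)
    (hm : m = ((1 + 2 * hexCriticalFugacity * Real.cos (5 * Real.pi / 24)) +
      (1 + 2 * hexCriticalFugacity * Real.cos (11 * Real.pi / 24))) *
      (2 * Real.sqrt 3 * hexCriticalFugacity * (Real.sin (Real.pi / 8) - c)))
    (hk : k = max (1 / 2) (1 - m / 10)) :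
    ‖1 + w * G₁ + w ^ 2 * G₂‖ ≤ k * S ∧ ‖1 + w * G₂ + w ^ 2 * G₁‖ ≤ k * S ∧
      ‖G₁ + w * 1 + w ^ 2 * G₂‖ ≤ k * S ∧ ‖G₁ + w * G₂ + w ^ 2 * 1‖ ≤ k * S ∧
      ‖G₂ + w * 1 + w ^ 2 * G₁‖ ≤ k * S ∧ ‖G₂ + w * G₁ + w ^ 2 * 1‖ ≤ k * S := by
  have x0 := nfb_xc_pos
  have hw3 : w ^ 3 = 1 := hw ▸ expI_two_pi_div_three_pow_three
  have hw1 : ‖w‖ = 1 := hw ▸ Complex.norm_exp_ofReal_mul_I _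
  set x := hexCriticalFugacity with hx
  -- closed forms of the three modes
  have hSum : (1 : ℂ) + G₁ + G₂ =
      ((1 + 2 * x * Real.cos (5 * Real.pi / 24) - Real.sqrt 3 / 2 * x * (Y + Y') : ℝ) : ℂ) +
        ((x / 2 * (Y' - Y) : ℝ) : ℂ) * Complex.I := by
    have h1 := one_add_xc_mul_sum'
    rw [hG₁, hG₂, hlam, hlam', hmu, hmu', expI_neg_five_pi_div_six, expI_five_pi_div_six]
    rw [← hx] at h1
    push_cast at h1 ⊢
    linear_combination h1
  have hL1 : 1 + w * G₁ + w ^ 2 * G₂ =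
      ((1 + 2 * x * Real.cos (11 * Real.pi / 24) + Real.sqrt 3 / 2 * x * (Y + Y') : ℝ) : ℂ) +
        ((x / 2 * (Y' - Y) : ℝ) : ℂ) * Complex.I := by
    have h1 := one_add_xc_mul_beta
    have h2 := omega_mul_expI_neg_five_pi_div_six
    have h3 := omega_sq_mul_expI_five_pi_div_six
    rw [hG₁, hG₂, hlam, hlam', hmu, hmu', hw]
    rw [← hx] at h1
    push_cast at h1 h2 h3 ⊢
    linear_combination h1 + ((x : ℂ) * Y) * h2 + ((x : ℂ) * Y') * h3
  have hL2 : 1 + w * G₂ + w ^ 2 * G₁ = ((x * (Y - Y') : ℝ) : ℂ) * Complex.I := by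
    have h1 := one_add_xc_mul_zero
    have h2 := omega_mul_expI_five_pi_div_six
    have h3 := omega_sq_mul_expI_neg_five_pi_div_six
    rw [hG₁, hG₂, hlam, hlam', hmu, hmu', hw]
    rw [← hx] at h1
    push_cast at h1 h2 h3 ⊢
    linear_combination h1 + ((x : ℂ) * Y') * h2 + ((x : ℂ) * Y) * h3
  -- norms
  have hS0 : 0 ≤ S := by rw [hS]; exact norm_nonneg _
  have nS : S ^ 2 = (1 + 2 * x * Real.cos (5 * Real.pi / 24) - Real.sqrt 3 / 2 * x * (Y + Y')) ^ 2
      + (x / 2 * (Y' - Y)) ^ 2 := by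
    rw [hS, hSum, Complex.sq_norm, Complex.normSq_add_mul_I]
  have nL1 : ‖1 + w * G₁ + w ^ 2 * G₂‖ ^ 2 =
      (1 + 2 * x * Real.cos (11 * Real.pi / 24) + Real.sqrt 3 / 2 * x * (Y + Y')) ^ 2 +
      (x / 2 * (Y' - Y)) ^ 2 := by
    rw [hL1, Complex.sq_norm, Complex.normSq_add_mul_I]
  have nL2 : ‖1 + w * G₂ + w ^ 2 * G₁‖ = x * |Y - Y'| := by
    rw [hL2, norm_mul, Complex.norm_I, mul_one, Complex.norm_real, Real.norm_eq_abs, abs_mul,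
      abs_of_pos x0]
  obtain ⟨hB1, hB2⟩ := partB_real hc hY0 hYc hY'0 hY'c hS0 (norm_nonneg _) nS nL1 hm hk
  rw [← nL2] at hB2
  -- the cyclic shifts
  refine ⟨hB1, hB2, ?_, ?_, ?_, ?_⟩
  · rw [show G₁ + w * 1 + w ^ 2 * G₂ = w * (1 + w * G₂ + w ^ 2 * G₁) by
      linear_combination (-G₁) * hw3, norm_mul, hw1, one_mul]
    exact hB2
  · rw [show G₁ + w * G₂ + w ^ 2 * 1 = w ^ 2 * (1 + w * G₁ + w ^ 2 * G₂) by
      linear_combination (-(G₁ + w * G₂)) * hw3, norm_mul, norm_pow, hw1, one_pow, one_mul]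
    exact hB1
  · rw [show G₂ + w * 1 + w ^ 2 * G₁ = w * (1 + w * G₁ + w ^ 2 * G₂) by
      linear_combination (-G₂) * hw3, norm_mul, hw1, one_mul]
    exact hB1
  · rw [show G₂ + w * G₁ + w ^ 2 * 1 = w ^ 2 * (1 + w * G₂ + w ^ 2 * G₁) by
      linear_combination (-(G₂ + w * G₁)) * hw3, norm_mul, norm_pow, hw1, one_pow, one_mul]
    exact hB2

/-! ## Part B of `stub_algebra` -/

/-- **Stub `stub_algebra`, part B (source triple).** For `c < sin(π/8)` there is `k < 1` such that
for `Z, Z' ∈ [0, c]`, `ε = ±1`, `F_u = 1`, `F₁ = x e(επ/3) + x e(4επ/3) Z`,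
`F₂ = x e(-επ/3) + x e(-4επ/3) Z'` (`e(t) = e^{-iσt}`, `σ = 5/8`, `x = x_c`), all six labellings
satisfy `‖G₀ + ωG₁ + ω²G₂‖ ≤ k ‖F_u + F₁ + F₂‖`; here `k = max(1/2, 1 - m/10)`,
`m = (α_T + β_T) · 2√3 x_c (sin(π/8) - c)`. -/
theorem stub_algebra_B :
    ∀ c : ℝ, c < Real.sin (Real.pi / 8) → ∃ k : ℝ, k < 1 ∧
      ∀ (ε : ℝ), (ε = 1 ∨ ε = -1) → ∀ (Z Z' : ℝ), 0 ≤ Z → Z ≤ c → 0 ≤ Z' → Z' ≤ c →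
      let x : ℝ := hexCriticalFugacity
      let e : ℝ → ℂ := fun t => Complex.exp (-Complex.I * (5 / 8 : ℝ) * t)
      let Fu : ℂ := 1
      let F₁ : ℂ := x * e (ε * (Real.pi / 3)) + x * e (4 * (ε * (Real.pi / 3))) * Z
      let F₂ : ℂ := x * e (-(ε * (Real.pi / 3))) + x * e (4 * (-(ε * (Real.pi / 3)))) * Z'
      let ω : ℂ := Complex.exp (2 * Real.pi * Complex.I / 3)
      let S : ℝ := ‖Fu + F₁ + F₂‖
      ‖Fu + ω * F₁ + ω ^ 2 * F₂‖ ≤ k * S ∧ ‖Fu + ω * F₂ + ω ^ 2 * F₁‖ ≤ k * S ∧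
      ‖F₁ + ω * Fu + ω ^ 2 * F₂‖ ≤ k * S ∧ ‖F₁ + ω * F₂ + ω ^ 2 * Fu‖ ≤ k * S ∧
      ‖F₂ + ω * Fu + ω ^ 2 * F₁‖ ≤ k * S ∧ ‖F₂ + ω * F₁ + ω ^ 2 * Fu‖ ≤ k * S := by
  intro c hc
  set m : ℝ := ((1 + 2 * hexCriticalFugacity * Real.cos (5 * Real.pi / 24)) +
      (1 + 2 * hexCriticalFugacity * Real.cos (11 * Real.pi / 24))) *
      (2 * Real.sqrt 3 * hexCriticalFugacity * (Real.sin (Real.pi / 8) - c)) with hm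
  refine ⟨max (1 / 2) (1 - m / 10), max_lt (by norm_num) (by linarith [margin_pos hc]), ?_⟩
  intro ε hε Z Z' hZ0 hZc hZ'0 hZ'c
  rcases hε with rfl | rfl
  · intro x e Fu F₁ F₂ ω S
    have eω : ω = Complex.exp ((2 * Real.pi / 3 : ℝ) * Complex.I) :=
      exp_eq_expI (by push_cast; ring)
    exact partB_core hc hZ0 hZc hZ'0 hZ'c (e (1 * (Real.pi / 3))) (e (-(1 * (Real.pi / 3))))
      (e (4 * (1 * (Real.pi / 3)))) (e (4 * (-(1 * (Real.pi / 3))))) ω F₁ F₂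
      (exp_eq_expI (by push_cast; ring)) (exp_eq_expI (by push_cast; ring))
      (exp_eq_expI (by push_cast; ring)) (exp_eq_expI (by push_cast; ring)) eω rfl rfl rfl hm rfl
  · intro x e Fu F₁ F₂ ω S
    have eω : ω = Complex.exp ((2 * Real.pi / 3 : ℝ) * Complex.I) :=
      exp_eq_expI (by push_cast; ring)
    have hS : S = ‖1 + F₂ + F₁‖ := by
      show ‖(1 : ℂ) + F₁ + F₂‖ = ‖1 + F₂ + F₁‖
      rw [add_right_comm]
    have h := partB_core hc hZ'0 hZ'c hZ0 hZc (e (-(-1 * (Real.pi / 3)))) (e (-1 * (Real.pi / 3)))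
      (e (4 * (-(-1 * (Real.pi / 3))))) (e (4 * (-1 * (Real.pi / 3)))) ω F₂ F₁
      (exp_eq_expI (by push_cast; ring)) (exp_eq_expI (by push_cast; ring))
      (exp_eq_expI (by push_cast; ring)) (exp_eq_expI (by push_cast; ring)) eω rfl rfl hS hm rfl
    exact ⟨h.2.1, h.1, h.2.2.2.2.1, h.2.2.2.2.2, h.2.2.1, h.2.2.2.1⟩

/-! ## The stub -/

/-- **Stub W2/W5 of the line `Ideator3Sketch` (the two finite-dimensional inequalities).**
(A, walled triple) If `P₁ = r₁θ`, `P₂ = r₂θ·e^{iσ·2επ/3}` (`r₁, r₂ ≥ 0`, `|θ| = 1`, `σ = 5/8`,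
`ε = ±1`) and `F_u = x(e(-επ/3)P₁ + e(επ/3)P₂)`, `F₁ = P₁ + x e(-επ/3) P₂`,
`F₂ = P₂ + x e(επ/3) P₁` with `e(t) = e^{-iσt}`, `x = x_c`, then for all six labellings
`‖G₀ + ωG₁ + ω²G₂‖ ≤ (β_T/α_T)‖F_u + F₁ + F₂‖`.
(B, source triple) For `c < sin(π/8)` there is `k < 1` such that for `Z, Z' ∈ [0, c]`, `ε = ±1`,
`F_u = 1`, `F₁ = x e(επ/3) + x e(4επ/3) Z`, `F₂ = x e(-επ/3) + x e(-4επ/3) Z'`, all six labellings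
satisfy `‖G₀ + ωG₁ + ω²G₂‖ ≤ k‖F_u + F₁ + F₂‖`. -/
theorem stub_algebra :
    (∀ (ε : ℝ), (ε = 1 ∨ ε = -1) → ∀ (r₁ r₂ : ℝ) (θ : ℂ), 0 ≤ r₁ → 0 ≤ r₂ → ‖θ‖ = 1 →
      let x : ℝ := hexCriticalFugacity
      let e : ℝ → ℂ := fun t => Complex.exp (-Complex.I * (5 / 8 : ℝ) * t)
      let P₁ : ℂ := r₁ * θ
      let P₂ : ℂ := r₂ * θ * Complex.exp (Complex.I * (5 / 8 : ℝ) * (2 * ε * Real.pi / 3 : ℝ))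
      let Fu : ℂ := x * (e (-(ε * (Real.pi / 3))) * P₁ + e (ε * (Real.pi / 3)) * P₂)
      let F₁ : ℂ := P₁ + x * e (-(ε * (Real.pi / 3))) * P₂
      let F₂ : ℂ := P₂ + x * e (ε * (Real.pi / 3)) * P₁
      let ω : ℂ := Complex.exp (2 * Real.pi * Complex.I / 3)
      let k : ℝ := (1 + 2 * hexCriticalFugacity * Real.cos (11 * Real.pi / 24)) /
        (1 + 2 * hexCriticalFugacity * Real.cos (5 * Real.pi / 24))
      let S : ℝ := ‖Fu + F₁ + F₂‖
      ‖Fu + ω * F₁ + ω ^ 2 * F₂‖ ≤ k * S ∧ ‖Fu + ω * F₂ + ω ^ 2 * F₁‖ ≤ k * S ∧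
      ‖F₁ + ω * Fu + ω ^ 2 * F₂‖ ≤ k * S ∧ ‖F₁ + ω * F₂ + ω ^ 2 * Fu‖ ≤ k * S ∧
      ‖F₂ + ω * Fu + ω ^ 2 * F₁‖ ≤ k * S ∧ ‖F₂ + ω * F₁ + ω ^ 2 * Fu‖ ≤ k * S) ∧
    (∀ c : ℝ, c < Real.sin (Real.pi / 8) → ∃ k : ℝ, k < 1 ∧
      ∀ (ε : ℝ), (ε = 1 ∨ ε = -1) → ∀ (Z Z' : ℝ), 0 ≤ Z → Z ≤ c → 0 ≤ Z' → Z' ≤ c →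
      let x : ℝ := hexCriticalFugacity
      let e : ℝ → ℂ := fun t => Complex.exp (-Complex.I * (5 / 8 : ℝ) * t)
      let Fu : ℂ := 1
      let F₁ : ℂ := x * e (ε * (Real.pi / 3)) + x * e (4 * (ε * (Real.pi / 3))) * Z
      let F₂ : ℂ := x * e (-(ε * (Real.pi / 3))) + x * e (4 * (-(ε * (Real.pi / 3)))) * Z'
      let ω : ℂ := Complex.exp (2 * Real.pi * Complex.I / 3)
      let S : ℝ := ‖Fu + F₁ + F₂‖
      ‖Fu + ω * F₁ + ω ^ 2 * F₂‖ ≤ k * S ∧ ‖Fu + ω * F₂ + ω ^ 2 * F₁‖ ≤ k * S ∧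
      ‖F₁ + ω * Fu + ω ^ 2 * F₂‖ ≤ k * S ∧ ‖F₁ + ω * F₂ + ω ^ 2 * Fu‖ ≤ k * S ∧
      ‖F₂ + ω * Fu + ω ^ 2 * F₁‖ ≤ k * S ∧ ‖F₂ + ω * F₁ + ω ^ 2 * Fu‖ ≤ k * S) :=
  ⟨stub_algebra_A, stub_algebra_B⟩

end Summit.CriticalPhenomena.SAWScalingLimit.Theorems.SAWDevelopingMapNoFoldBound
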